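import Summits.MatrixMultiplication.OmegaCensus.MetacyclicBoxPattern
import Summits.MatrixMultiplication.OmegaCensus.PhaseArcs

/-!
# ω-census, family (b3): conjecture C9 on the Frobenius / metacyclic family — phase-arc patterns are independent (`PhaseArcs` ⟶ `ABox.PatIndep`)

HONEST FRAMING (pub-omega census; verbatim): lottery ticket; floor = certified bounds/negative ranges.
Census BOOKKEEPING (conjecture C9 of the cell; pub-omega stpp-1 gen 20).  Layer 2 of the seat's uniform construction for
`ℤ/p ⋊_u ℤ/q` (design note HOME/pub-omega-stpp-1-g20/UNIFORM-FROBENIUS-DESIGN.md), valid for every `q`.  For a box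
`D : MetaCyc.ABox p q` every forbidden difference is `dd c c' = u^{s₁}α_{i'} − u^{s₁}β_j + u^{s₂}β_{j'} − u^{s₃}α_i`
(`s₁ = a_i + b_{j'}`, `s₂ = a_i + b_j`, `s₃ = a_{i'} + b_{j'}`), a signed sum of four of the `6q` products `u^s α_i`, `u^s β_j`.
Data: integers `aα s i, eα s i` (`aβ s j, eβ s j`) with `8·(u^s α_i).val = aα s i · p + eα s i` — the PHASE (eighths of the
circle `ℤ/p`) and the ERROR of each product; a phase pattern `P c ⊆ ℤ` (phases used in column `c`) and trims `lo, hi ≥ 0`.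
The cell set `phaseCells p P lo hi` = the `(c, A)` with `φ p + lo c φ ≤ 8·A.val` and `8·A.val + hi c φ < (φ+1) p` for some
`φ ∈ P c` (unions of trimmed phase blocks).  THEOREM `patIndep_phaseCells`: if every ordered pair of distinct columns and
phases `φ ∈ P c`, `φ' ∈ P c'` satisfies the finite condition `PairOK` (`2|E| < p`; `φ − φ' ≢ Φ (mod 8)`; the two trim
conditions for `φ − φ' ≡ Φ ± 1`) with `Φ = PhiOf D aα aβ c c'` (signed sum of the four phases) and `E = EOf D eα eβ c c'`
(signed sum of the four errors), then the cell set is an independent pattern (`ABox.PatIndep`), ready for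
`ABox.not_boxUseful_of_pattern`.  Proof: lift the `ZMod p` equation `A − A' = dd c c'` to `8(A − A') = (Φ + 8j)·p + E` over
`ℤ` and apply `PhaseArcs.no_conflict`.  `PairOK` is decidable: numeric certificates discharge the hypothesis by `decide`, the
uniform theorem from per-class tables.  Nothing here is progress on `ω`.
-/

namespace Summit.MatrixMultiplication.OmegaCensus

open Finset

namespace MetaCyc.ABox

/-- A column never forbids a difference to itself: `dd c c = 0`. [folklore] -/
theorem dd_self {N q : ℕ} (u : ZMod N) (D : MetaCyc.ABox N q) (c : Fin 3 × Fin 3) : D.dd u c c = 0 := by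
  simp only [dd]; ring

/-- `dd` as a signed sum of four products `u^s·α_i`, `u^s·β_j`. [folklore] -/
theorem dd_eq_four {N q : ℕ} (u : ZMod N) (D : MetaCyc.ABox N q) (c c' : Fin 3 × Fin 3) :
    D.dd u c c' = act u (D.a c.1 + D.b c'.2) * D.α c'.1 - act u (D.a c.1 + D.b c'.2) * D.β c.2
      + act u (D.a c.1 + D.b c.2) * D.β c'.2 - act u (D.a c'.1 + D.b c'.2) * D.α c.1 := by
  simp only [dd]; ring

end MetaCyc.ABox

namespace PhaseArcs

variable {p q : ℕ}

/-- The phase-arc cell set: `(c, A)` with `A` in a trimmed phase block `φ ∈ P c`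
(`φ p + lo c φ ≤ 8·A.val`, `8·A.val + hi c φ < (φ+1) p`). [folklore] -/
def phaseCells (p : ℕ) [NeZero p] (P : Fin 3 × Fin 3 → Finset ℤ) (lo hi : Fin 3 × Fin 3 → ℤ → ℤ) :
    Finset ((Fin 3 × Fin 3) × ZMod p) :=
  univ.filter fun x => ∃ φ ∈ P x.1,
    φ * p + lo x.1 φ ≤ 8 * (x.2.val : ℤ) ∧ 8 * (x.2.val : ℤ) + hi x.1 φ < (φ + 1) * p

/-- Membership in the phase-arc cell set. [folklore] -/
theorem mem_phaseCells [NeZero p] {P : Fin 3 × Fin 3 → Finset ℤ} {lo hi : Fin 3 × Fin 3 → ℤ → ℤ}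
    {x : (Fin 3 × Fin 3) × ZMod p} :
    x ∈ phaseCells p P lo hi ↔ ∃ φ ∈ P x.1,
      φ * p + lo x.1 φ ≤ 8 * (x.2.val : ℤ) ∧ 8 * (x.2.val : ℤ) + hi x.1 φ < (φ + 1) * p := by
  simp only [phaseCells, mem_filter, mem_univ, true_and]

/-- The phase shift `Φ(c,c')` of a column pair: the signed sum of the phases of the four products in `dd c c'`. [folklore] -/
def PhiOf (D : MetaCyc.ABox p q) (aα aβ : ZMod q → Fin 3 → ℤ) (c c' : Fin 3 × Fin 3) : ℤ :=
  aα (D.a c.1 + D.b c'.2) c'.1 - aβ (D.a c.1 + D.b c'.2) c.2 + aβ (D.a c.1 + D.b c.2) c'.2 - aα (D.a c'.1 + D.b c'.2) c.1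

/-- The error `E(c,c')` of a column pair: the signed sum of the errors of the four products in `dd c c'`. [folklore] -/
def EOf (D : MetaCyc.ABox p q) (eα eβ : ZMod q → Fin 3 → ℤ) (c c' : Fin 3 × Fin 3) : ℤ :=
  eα (D.a c.1 + D.b c'.2) c'.1 - eβ (D.a c.1 + D.b c'.2) c.2 + eβ (D.a c.1 + D.b c.2) c'.2 - eα (D.a c'.1 + D.b c'.2) c.1

/-- The finite condition on a pair of phases `φ ∈ P c`, `φ' ∈ P c'`: small error, main pattern condition, two trim conditions
(the hypotheses of `PhaseArcs.no_conflict`). [folklore] -/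
def PairOK (p : ℕ) (Φ E φ φ' loφ hiφ loφ' hiφ' : ℤ) : Prop :=
  2 * |E| < p ∧ (φ - φ' - Φ) % 8 ≠ 0 ∧
    ((φ - φ' - Φ - 1) % 8 = 0 → 0 < E → E ≤ hiφ' ∨ E ≤ loφ) ∧
    ((φ - φ' - Φ + 1) % 8 = 0 → E < 0 → -E ≤ loφ' ∨ -E ≤ hiφ)

/-- `PairOK` is decidable. [folklore] -/
instance (p : ℕ) (Φ E φ φ' loφ hiφ loφ' hiφ' : ℤ) : Decidable (PairOK p Φ E φ φ' loφ hiφ loφ' hiφ') := by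
  unfold PairOK; infer_instance

/-- **Phase-arc patterns are independent.** See the module docstring. [folklore] -/
theorem patIndep_phaseCells [NeZero p] [NeZero q] (D : MetaCyc.ABox p q) (u : ZMod p)
    (aα eα aβ eβ : ZMod q → Fin 3 → ℤ)
    (hα : ∀ s i, 8 * ((MetaCyc.act u s * D.α i).val : ℤ) = aα s i * p + eα s i)
    (hβ : ∀ s j, 8 * ((MetaCyc.act u s * D.β j).val : ℤ) = aβ s j * p + eβ s j)
    (P : Fin 3 × Fin 3 → Finset ℤ) (lo hi : Fin 3 × Fin 3 → ℤ → ℤ)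
    (hlo : ∀ c, ∀ φ ∈ P c, 0 ≤ lo c φ) (hhi : ∀ c, ∀ φ ∈ P c, 0 ≤ hi c φ)
    (hcond : ∀ c c', c ≠ c' → ∀ φ ∈ P c, ∀ φ' ∈ P c',
      PairOK p (PhiOf D aα aβ c c') (EOf D eα eβ c c') φ φ' (lo c φ) (hi c φ) (lo c' φ') (hi c' φ')) :
    D.PatIndep u (phaseCells p P lo hi) := by
  intro x hx y hy hxy heq
  obtain ⟨φ, hφ, hx1, hx2⟩ := mem_phaseCells.1 hx
  obtain ⟨φ', hφ', hy1, hy2⟩ := mem_phaseCells.1 hy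
  have hp : (0 : ℤ) < p := by have := NeZero.pos p; exact_mod_cast this
  by_cases hc : x.1 = y.1
  · -- same column: `dd = 0`, so `A = A'`, so `x = y`
    rw [hc, MetaCyc.ABox.dd_self, sub_eq_zero] at heq
    exact hxy (Prod.ext hc heq)
  obtain ⟨hE, h0, hplus, hminus⟩ := hcond x.1 y.1 hc φ hφ φ' hφ'
  -- the four products occurring in `dd x.1 y.1`
  set s₁ : ZMod q := D.a x.1.1 + D.b y.1.2 with hs₁
  set s₂ : ZMod q := D.a x.1.1 + D.b x.1.2 with hs₂
  set s₃ : ZMod q := D.a y.1.1 + D.b y.1.2 with hs₃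
  set A : ℤ := (x.2.val : ℤ) with hA
  set A' : ℤ := (y.2.val : ℤ) with hA'
  set v₁ : ℤ := ((MetaCyc.act u s₁ * D.α y.1.1).val : ℤ) with hv₁
  set v₂ : ℤ := ((MetaCyc.act u s₁ * D.β x.1.2).val : ℤ) with hv₂
  set v₃ : ℤ := ((MetaCyc.act u s₂ * D.β y.1.2).val : ℤ) with hv₃
  set v₄ : ℤ := ((MetaCyc.act u s₃ * D.α x.1.1).val : ℤ) with hv₄
  -- lift the `ZMod p` equation to `ℤ`
  have hcast : ((A - A' - (v₁ - v₂ + v₃ - v₄) : ℤ) : ZMod p) = 0 := by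
    rw [MetaCyc.ABox.dd_eq_four] at heq
    simp only [hA, hA', hv₁, hv₂, hv₃, hv₄]
    push_cast
    simp only [ZMod.natCast_val, ZMod.cast_id', id_eq]
    linear_combination heq
  obtain ⟨j, hj⟩ := (ZMod.intCast_zmod_eq_zero_iff_dvd _ p).1 hcast
  have h₁ := hα s₁ y.1.1
  have h₂ := hβ s₁ x.1.2
  have h₃ := hβ s₂ y.1.2
  have h₄ := hα s₃ x.1.1
  have key : 8 * (A - A') = (PhiOf D aα aβ x.1 y.1 + 8 * j) * p + EOf D eα eβ x.1 y.1 := by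
    simp only [PhiOf, EOf, ← hs₁, ← hs₂, ← hs₃]
    linear_combination 8 * hj + h₁ - h₂ + h₃ - h₄
  exact no_conflict (δ := A - A' - j * p) (j := j) hp hx1 hx2 hy1 hy2 (hlo _ _ hφ) (hhi _ _ hφ) (hlo _ _ hφ') (hhi _ _ hφ') hE
    (by linear_combination key) (by ring) h0 hplus hminus

end PhaseArcs

end Summit.MatrixMultiplication.OmegaCensus
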